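import Mathlib
import Summits.Ventures.PercRepro2.Tail2D
import Summits.Ventures.PercRepro2.Tail2DSP
import Summits.Ventures.PercRepro2.Tail2DExchange
import Summits.Ventures.PercRepro2.Tail2DThreePoint
import Summits.Ventures.PercRepro2.Tail2DPairSign
import Summits.Ventures.PercRepro2.Tail2DFlowTwoLemmas
import Summits.Ventures.PercRepro2.Tail2DFlowTwo
import Summits.Ventures.PercRepro2.Tail2DTransportLemmas
import Summits.Ventures.PercRepro2.V2SP
import Summits.Ventures.PercRepro2.Tail2DCount
import Summits.Ventures.PercRepro2.Tail2DThreePointComm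

/-!
# The transport step of the six-point convolution (seat mine-b, cell pub-perc-repro2)

The six-point convolution `hconv` (Tail2DFlowTwo.lean) of an M♮-concave tail with the law of a max-flow-2
network is M♮-concave under the six MINOR inequalities of the flow-two step.  Wide series–parallel laws
violate them: `(e∗e) ∧ P(e^d)` has `n₁₀ n₀₁ = (d+2)² < n₁₁ n₀₀ = 4(2^d − 2)` for `d ≥ 4`, and
`(e∗e) ∧ P(e^5)` also violates the row and column minors — while their tails are M♮ on the census.

This file proves the step under TRANSPORT hypotheses instead (conjectures/MINE-B.md §33): every unsigned
pair coefficient of the three exchange defects is paid for by SEVERAL inner pairs at once, the weight of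
the outer pair being split among absorbers whose absorption lemmas hold (`absorb_two`, `absorb_split`):
* `m2`: `(R2) n₀₀ n₂₀ ≤ n₁₀² + n₁₀ n₂₀`, `(E) n₂₀ n₀₁ ≤ n₁₀ n₁₁`, `(S) n₂₀ n₀₂ ≤ n₁₁²`;
* `m4`: the mirror `(C2) n₀₀ n₀₂ ≤ n₀₁² + n₀₁ n₀₂`, `(E′) n₀₂ n₁₀ ≤ n₀₁ n₁₁`, `(S)`;
* `m1`: `(R1) n₀₀ n₂₀ ≤ n₁₀² + n₁₀ n₁₁`, `(C1) n₀₀ n₀₂ ≤ n₀₁² + n₀₁ n₁₁`, and the split condition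
  `(L1) n₀₀ n₁₁ ≤ n₁₀ n₀₁ + min(n₀₁ n₂₀, n₀₂ n₁₀)` — the pair `{(1,1),(0,0)}` is paid for by
  `{(1,0),(0,1)}` (the old absorption) and by the COUPLE `{(0,1),(2,0)}`, `{(0,2),(1,0)}` through the
  three-term lemma `abs1_T3`.
These hold on every six-point series–parallel law with at most 10 edges (1,494 / 1,494 distinct laws,
census e53) and on `(e∗e) ∧ P(e^d)` for every `d` (`hconv_isMTail'`).
-/

namespace Summit.Ventures.PercRepro2.Tail2D

section Transport

variable {T : ℤ → ℤ → ℝ} {L : ℤ} (hT : IsMTail T L) {n00 n10 n01 n20 n11 n02 : ℝ}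

include hT

/-- the skew inequality `m2` of the six-point convolution under the transport hypotheses -/
lemma hconv_m2' (h00 : 0 ≤ n00) (h10 : 0 ≤ n10) (h01 : 0 ≤ n01) (h20 : 0 ≤ n20) (h11 : 0 ≤ n11)
    (h02 : 0 ≤ n02) (hR : n00 * n20 ≤ n10 * n10 + n10 * n20) (hE : n20 * n01 ≤ n10 * n11)
    (hS : n20 * n02 ≤ n11 * n11) (a b : ℤ) :
    hconv n00 n10 n01 n20 n11 n02 T (a + 2) (b - 1) * hconv n00 n10 n01 n20 n11 n02 T a b
      ≤ hconv n00 n10 n01 n20 n11 n02 T (a + 1) b * hconv n00 n10 n01 n20 n11 n02 T (a + 1) (b - 1) := by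
  have hD : hconv n00 n10 n01 n20 n11 n02 T (a + 2) (b - 1) * hconv n00 n10 n01 n20 n11 n02 T a b
      - hconv n00 n10 n01 n20 n11 n02 T (a + 1) b * hconv n00 n10 n01 n20 n11 n02 T (a + 1) (b - 1)
      = n00 * n00 * crossB T a b a b + n10 * n10 * crossB T (a - 1) b (a - 1) b
        + n01 * n01 * crossB T a (b - 1) a (b - 1) + n20 * n20 * crossB T (a - 2) b (a - 2) b
        + n11 * n11 * crossB T (a - 1) (b - 1) (a - 1) (b - 1) + n02 * n02 * crossB T a (b - 2) a (b - 2)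
        + n00 * n10 * (crossB T a b (a - 1) b + crossB T (a - 1) b a b)
        + n00 * n01 * (crossB T a b a (b - 1) + crossB T a (b - 1) a b)
        + n00 * n20 * (crossB T a b (a - 2) b + crossB T (a - 2) b a b)
        + n00 * n11 * (crossB T a b (a - 1) (b - 1) + crossB T (a - 1) (b - 1) a b)
        + n00 * n02 * (crossB T a b a (b - 2) + crossB T a (b - 2) a b)
        + n10 * n01 * (crossB T (a - 1) b a (b - 1) + crossB T a (b - 1) (a - 1) b)
        + n10 * n20 * (crossB T (a - 1) b (a - 2) b + crossB T (a - 2) b (a - 1) b)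
        + n10 * n11 * (crossB T (a - 1) b (a - 1) (b - 1) + crossB T (a - 1) (b - 1) (a - 1) b)
        + n10 * n02 * (crossB T (a - 1) b a (b - 2) + crossB T a (b - 2) (a - 1) b)
        + n01 * n20 * (crossB T a (b - 1) (a - 2) b + crossB T (a - 2) b a (b - 1))
        + n01 * n11 * (crossB T a (b - 1) (a - 1) (b - 1) + crossB T (a - 1) (b - 1) a (b - 1))
        + n01 * n02 * (crossB T a (b - 1) a (b - 2) + crossB T a (b - 2) a (b - 1))
        + n20 * n11 * (crossB T (a - 2) b (a - 1) (b - 1) + crossB T (a - 1) (b - 1) (a - 2) b)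
        + n20 * n02 * (crossB T (a - 2) b a (b - 2) + crossB T a (b - 2) (a - 2) b)
        + n11 * n02 * (crossB T (a - 1) (b - 1) a (b - 2) + crossB T a (b - 2) (a - 1) (b - 1)) := by
    unfold hconv crossB; ring_nf
  -- the signed terms
  have d00 := hT.crossB_nonpos (u₁ := a) (u₂ := b) (v₁ := a) (v₂ := b) (by omega) le_rfl
  have d10 := hT.crossB_nonpos (u₁ := a - 1) (u₂ := b) (v₁ := a - 1) (v₂ := b) (by omega) le_rfl
  have d01 := hT.crossB_nonpos (u₁ := a) (u₂ := b - 1) (v₁ := a) (v₂ := b - 1) (by omega) le_rfl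
  have d20 := hT.crossB_nonpos (u₁ := a - 2) (u₂ := b) (v₁ := a - 2) (v₂ := b) (by omega) le_rfl
  have d11 := hT.crossB_nonpos (u₁ := a - 1) (u₂ := b - 1) (v₁ := a - 1) (v₂ := b - 1) (by omega) le_rfl
  have d02 := hT.crossB_nonpos (u₁ := a) (u₂ := b - 2) (v₁ := a) (v₂ := b - 2) (by omega) le_rfl
  have g1 := hT.pair_coeff_nonpos (u₁ := a) (u₂ := b) (v₁ := a - 1) (v₂ := b) (by rw [abs_le]; omega)
  have g2 := hT.pair_coeff_nonpos (u₁ := a) (u₂ := b) (v₁ := a) (v₂ := b - 1) (by rw [abs_le]; omega)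
  have g3 := hT.pair_coeff_nonpos (u₁ := a) (u₂ := b) (v₁ := a - 1) (v₂ := b - 1) (by rw [abs_le]; omega)
  have g4 := hT.pair_coeff_nonpos (u₁ := a) (u₂ := b) (v₁ := a) (v₂ := b - 2) (by rw [abs_le]; omega)
  have g5 := hT.pair_coeff_nonpos (u₁ := a - 1) (u₂ := b) (v₁ := a) (v₂ := b - 1) (by rw [abs_le]; omega)
  have g6 := hT.pair_coeff_nonpos (u₁ := a - 1) (u₂ := b) (v₁ := a - 2) (v₂ := b) (by rw [abs_le]; omega)
  have g7 := hT.pair_coeff_nonpos (u₁ := a - 1) (u₂ := b) (v₁ := a - 1) (v₂ := b - 1) (by rw [abs_le]; omega)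
  have g8 := hT.pair_coeff_nonpos (u₁ := a - 1) (u₂ := b) (v₁ := a) (v₂ := b - 2) (by rw [abs_le]; omega)
  have g9 := hT.pair_coeff_nonpos (u₁ := a) (u₂ := b - 1) (v₁ := a - 1) (v₂ := b - 1) (by rw [abs_le]; omega)
  have g10 := hT.pair_coeff_nonpos (u₁ := a) (u₂ := b - 1) (v₁ := a) (v₂ := b - 2) (by rw [abs_le]; omega)
  have g11 := hT.pair_coeff_nonpos (u₁ := a - 2) (u₂ := b) (v₁ := a - 1) (v₂ := b - 1) (by rw [abs_le]; omega)
  have g12 := hT.pair_coeff_nonpos (u₁ := a - 1) (u₂ := b - 1) (v₁ := a) (v₂ := b - 2) (by rw [abs_le]; omega)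
  -- the absorptions: {(2,0),(0,0)} into {(1,0)²} and {(1,0),(2,0)}; {(2,0),(0,1)} into {(1,0),(1,1)};
  -- {(2,0),(0,2)} into {(1,1)²}
  have A1 := absorb_two (PO := n00 * n20) (P1 := n10 * n10) (P2 := n10 * n20)
    (cO := crossB T a b (a - 2) b + crossB T (a - 2) b a b) (c1 := crossB T (a - 1) b (a - 1) b)
    (c2 := crossB T (a - 1) b (a - 2) b + crossB T (a - 2) b (a - 1) b)
    (mul_nonneg h00 h20) (mul_nonneg h10 h10) (mul_nonneg h10 h20) hR d10 g6
    (by linarith [hT.abs2_E0 a b]) (by linarith [hT.abs2_N2b a b])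
  have A2 := absorb (PO := n01 * n20) (PI := n10 * n11)
    (cO := crossB T a (b - 1) (a - 2) b + crossB T (a - 2) b a (b - 1))
    (cI := crossB T (a - 1) b (a - 1) (b - 1) + crossB T (a - 1) (b - 1) (a - 1) b)
    (mul_nonneg h01 h20) (by linarith [hE]) g7 (by linarith [hT.abs2_Em1 a b])
  have A3 := absorb (PO := n20 * n02) (PI := n11 * n11)
    (cO := crossB T (a - 2) b a (b - 2) + crossB T a (b - 2) (a - 2) b)
    (cI := crossB T (a - 1) (b - 1) (a - 1) (b - 1)) (mul_nonneg h20 h02) hS d11 (by linarith [hT.abs2_Wm2 a b])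
  have f00 := mulnp (mul_nonneg h00 h00) d00
  have f01 := mulnp (mul_nonneg h01 h01) d01
  have f20 := mulnp (mul_nonneg h20 h20) d20
  have f02 := mulnp (mul_nonneg h02 h02) d02
  have e1 := mulnp (mul_nonneg h00 h10) g1
  have e2 := mulnp (mul_nonneg h00 h01) g2
  have e3 := mulnp (mul_nonneg h00 h11) g3
  have e4 := mulnp (mul_nonneg h00 h02) g4
  have e5 := mulnp (mul_nonneg h10 h01) g5
  have e8 := mulnp (mul_nonneg h10 h02) g8
  have e9 := mulnp (mul_nonneg h01 h11) g9
  have e10 := mulnp (mul_nonneg h01 h02) g10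
  have e11 := mulnp (mul_nonneg h20 h11) g11
  have e12 := mulnp (mul_nonneg h11 h02) g12
  linarith [hD, A1, A2, A3, f00, f01, f20, f02, e1, e2, e3, e4, e5, e8, e9, e10, e11, e12]

/-- the log-submodularity `m1` of the six-point convolution under the transport hypotheses -/
lemma hconv_m1' (h00 : 0 ≤ n00) (h10 : 0 ≤ n10) (h01 : 0 ≤ n01) (h20 : 0 ≤ n20) (h11 : 0 ≤ n11)
    (h02 : 0 ≤ n02) (hR : n00 * n20 ≤ n10 * n10 + n10 * n11) (hC : n00 * n02 ≤ n01 * n01 + n01 * n11)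
    (hΛa : n00 * n11 ≤ n10 * n01 + n01 * n20) (hΛb : n00 * n11 ≤ n10 * n01 + n10 * n02) (a b : ℤ) :
    hconv n00 n10 n01 n20 n11 n02 T (a + 1) (b + 1) * hconv n00 n10 n01 n20 n11 n02 T a b
      ≤ hconv n00 n10 n01 n20 n11 n02 T (a + 1) b * hconv n00 n10 n01 n20 n11 n02 T a (b + 1) := by
  have hD : hconv n00 n10 n01 n20 n11 n02 T (a + 1) (b + 1) * hconv n00 n10 n01 n20 n11 n02 T a b
      - hconv n00 n10 n01 n20 n11 n02 T (a + 1) b * hconv n00 n10 n01 n20 n11 n02 T a (b + 1)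
      = n00 * n00 * crossB1 T a b a b + n10 * n10 * crossB1 T (a - 1) b (a - 1) b
        + n01 * n01 * crossB1 T a (b - 1) a (b - 1) + n20 * n20 * crossB1 T (a - 2) b (a - 2) b
        + n11 * n11 * crossB1 T (a - 1) (b - 1) (a - 1) (b - 1) + n02 * n02 * crossB1 T a (b - 2) a (b - 2)
        + n00 * n10 * (crossB1 T a b (a - 1) b + crossB1 T (a - 1) b a b)
        + n00 * n01 * (crossB1 T a b a (b - 1) + crossB1 T a (b - 1) a b)
        + n00 * n20 * (crossB1 T a b (a - 2) b + crossB1 T (a - 2) b a b)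
        + n00 * n11 * (crossB1 T a b (a - 1) (b - 1) + crossB1 T (a - 1) (b - 1) a b)
        + n00 * n02 * (crossB1 T a b a (b - 2) + crossB1 T a (b - 2) a b)
        + n10 * n01 * (crossB1 T (a - 1) b a (b - 1) + crossB1 T a (b - 1) (a - 1) b)
        + n10 * n20 * (crossB1 T (a - 1) b (a - 2) b + crossB1 T (a - 2) b (a - 1) b)
        + n10 * n11 * (crossB1 T (a - 1) b (a - 1) (b - 1) + crossB1 T (a - 1) (b - 1) (a - 1) b)
        + n10 * n02 * (crossB1 T (a - 1) b a (b - 2) + crossB1 T a (b - 2) (a - 1) b)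
        + n01 * n20 * (crossB1 T a (b - 1) (a - 2) b + crossB1 T (a - 2) b a (b - 1))
        + n01 * n11 * (crossB1 T a (b - 1) (a - 1) (b - 1) + crossB1 T (a - 1) (b - 1) a (b - 1))
        + n01 * n02 * (crossB1 T a (b - 1) a (b - 2) + crossB1 T a (b - 2) a (b - 1))
        + n20 * n11 * (crossB1 T (a - 2) b (a - 1) (b - 1) + crossB1 T (a - 1) (b - 1) (a - 2) b)
        + n20 * n02 * (crossB1 T (a - 2) b a (b - 2) + crossB1 T a (b - 2) (a - 2) b)
        + n11 * n02 * (crossB1 T (a - 1) (b - 1) a (b - 2) + crossB1 T a (b - 2) (a - 1) (b - 1)) := by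
    unfold hconv crossB1; ring_nf
  have d00 := hT.crossB1_nonpos (u₁ := a) (u₂ := b) (v₁ := a) (v₂ := b) le_rfl (by omega)
  have d10 := hT.crossB1_nonpos (u₁ := a - 1) (u₂ := b) (v₁ := a - 1) (v₂ := b) le_rfl (by omega)
  have d01 := hT.crossB1_nonpos (u₁ := a) (u₂ := b - 1) (v₁ := a) (v₂ := b - 1) le_rfl (by omega)
  have d20 := hT.crossB1_nonpos (u₁ := a - 2) (u₂ := b) (v₁ := a - 2) (v₂ := b) le_rfl (by omega)
  have d11 := hT.crossB1_nonpos (u₁ := a - 1) (u₂ := b - 1) (v₁ := a - 1) (v₂ := b - 1) le_rfl (by omega)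
  have d02 := hT.crossB1_nonpos (u₁ := a) (u₂ := b - 2) (v₁ := a) (v₂ := b - 2) le_rfl (by omega)
  have g1 := hT.pair1_nonpos (u₁ := a) (u₂ := b) (v₁ := a - 1) (v₂ := b) (by rw [abs_le]; omega)
  have g2 := hT.pair1_nonpos (u₁ := a) (u₂ := b) (v₁ := a) (v₂ := b - 1) (by rw [abs_le]; omega)
  have g5 := hT.pair1_nonpos (u₁ := a - 1) (u₂ := b) (v₁ := a) (v₂ := b - 1) (by rw [abs_le]; omega)
  have g6 := hT.pair1_nonpos (u₁ := a - 1) (u₂ := b) (v₁ := a - 2) (v₂ := b) (by rw [abs_le]; omega)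
  have g7 := hT.pair1_nonpos (u₁ := a - 1) (u₂ := b) (v₁ := a - 1) (v₂ := b - 1) (by rw [abs_le]; omega)
  have g8 := hT.pair1_nonpos (u₁ := a - 1) (u₂ := b) (v₁ := a) (v₂ := b - 2) (by rw [abs_le]; omega)
  have g9 := hT.pair1_nonpos (u₁ := a) (u₂ := b - 1) (v₁ := a - 2) (v₂ := b) (by rw [abs_le]; omega)
  have g10 := hT.pair1_nonpos (u₁ := a) (u₂ := b - 1) (v₁ := a - 1) (v₂ := b - 1) (by rw [abs_le]; omega)
  have g11 := hT.pair1_nonpos (u₁ := a) (u₂ := b - 1) (v₁ := a) (v₂ := b - 2) (by rw [abs_le]; omega)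
  have g12 := hT.pair1_nonpos (u₁ := a - 2) (u₂ := b) (v₁ := a - 1) (v₂ := b - 1) (by rw [abs_le]; omega)
  have g13 := hT.pair1_nonpos (u₁ := a - 2) (u₂ := b) (v₁ := a) (v₂ := b - 2) (by rw [abs_le]; omega)
  have g14 := hT.pair1_nonpos (u₁ := a - 1) (u₂ := b - 1) (v₁ := a) (v₂ := b - 2) (by rw [abs_le]; omega)
  -- {(2,0),(0,0)} into {(1,0)²} and {(1,0),(1,1)}
  have A1 := absorb_two (PO := n00 * n20) (P1 := n10 * n10) (P2 := n10 * n11)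
    (cO := crossB1 T a b (a - 2) b + crossB1 T (a - 2) b a b) (c1 := crossB1 T (a - 1) b (a - 1) b)
    (c2 := crossB1 T (a - 1) b (a - 1) (b - 1) + crossB1 T (a - 1) (b - 1) (a - 1) b)
    (mul_nonneg h00 h20) (mul_nonneg h10 h10) (mul_nonneg h10 h11) hR d10 g7
    (by linarith [hT.abs1_L1 a b]) (by linarith [hT.abs1_N1 a b])
  -- {(0,2),(0,0)} into {(0,1)²} and {(0,1),(1,1)}
  have A2 := absorb_two (PO := n00 * n02) (P1 := n01 * n01) (P2 := n01 * n11)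
    (cO := crossB1 T a b a (b - 2) + crossB1 T a (b - 2) a b) (c1 := crossB1 T a (b - 1) a (b - 1))
    (c2 := crossB1 T a (b - 1) (a - 1) (b - 1) + crossB1 T (a - 1) (b - 1) a (b - 1))
    (mul_nonneg h00 h02) (mul_nonneg h01 h01) (mul_nonneg h01 h11) hC d01 g10
    (by linarith [hT.abs1_L2 a b]) (by linarith [hT.abs1_N1' a b])
  -- {(1,1),(0,0)} into {(0,1),(1,0)} and the couple {(0,1),(2,0)}, {(0,2),(1,0)}
  have A3 := absorb_split (PO := n00 * n11) (PI := n10 * n01) (P2 := n01 * n20) (P3 := n10 * n02)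
    (cO := crossB1 T a b (a - 1) (b - 1) + crossB1 T (a - 1) (b - 1) a b)
    (cI := crossB1 T (a - 1) b a (b - 1) + crossB1 T a (b - 1) (a - 1) b)
    (c2 := crossB1 T a (b - 1) (a - 2) b + crossB1 T (a - 2) b a (b - 1))
    (c3 := crossB1 T (a - 1) b a (b - 2) + crossB1 T a (b - 2) (a - 1) b)
    (mul_nonneg h00 h11) (mul_nonneg h10 h01) (mul_nonneg h01 h20) (mul_nonneg h10 h02) hΛa hΛb
    g5 g9 g8 (by linarith [hT.abs1_L3 a b]) (by linarith [hT.abs1_T3 a b])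
  have f00 := mulnp (mul_nonneg h00 h00) d00
  have f20 := mulnp (mul_nonneg h20 h20) d20
  have f11 := mulnp (mul_nonneg h11 h11) d11
  have f02 := mulnp (mul_nonneg h02 h02) d02
  have e1 := mulnp (mul_nonneg h00 h10) g1
  have e2 := mulnp (mul_nonneg h00 h01) g2
  have e6 := mulnp (mul_nonneg h10 h20) g6
  have e11 := mulnp (mul_nonneg h01 h02) g11
  have e12 := mulnp (mul_nonneg h20 h11) g12
  have e13 := mulnp (mul_nonneg h20 h02) g13
  have e14 := mulnp (mul_nonneg h11 h02) g14
  linarith [hD, A1, A2, A3, f00, f20, f11, f02, e1, e2, e6, e11, e12, e13, e14]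

/-- **the transport step**: the six-point convolution of an M♮-concave tail with weights satisfying the
transport hypotheses (and a positive top level) is an M♮-concave tail of level `L + 2` -/
theorem hconv_isMTail' (h00 : 0 ≤ n00) (h10 : 0 ≤ n10) (h01 : 0 ≤ n01) (h20 : 0 < n20) (h11 : 0 < n11)
    (h02 : 0 < n02) (hR2 : n00 * n20 ≤ n10 * n10 + n10 * n20) (hC2 : n00 * n02 ≤ n01 * n01 + n01 * n02)
    (hS : n20 * n02 ≤ n11 * n11) (hE : n20 * n01 ≤ n10 * n11) (hE' : n02 * n10 ≤ n01 * n11)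
    (hR1 : n00 * n20 ≤ n10 * n10 + n10 * n11) (hC1 : n00 * n02 ≤ n01 * n01 + n01 * n11)
    (hΛa : n00 * n11 ≤ n10 * n01 + n01 * n20) (hΛb : n00 * n11 ≤ n10 * n01 + n10 * n02) :
    IsMTail (hconv n00 n10 n01 n20 n11 n02 T) (L + 2) where
  L_nonneg := by have := hT.L_nonneg; omega
  clip₁ := by
    intro a b h; simp only [hconv]
    rw [hT.clip₁ a b h, hT.clip₁ (a - 1) b (by omega), hT.clip₁ (0 - 1) b (by omega),
      hT.clip₁ a (b - 1) h, hT.clip₁ (a - 2) b (by omega), hT.clip₁ (0 - 2) b (by omega),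
      hT.clip₁ (a - 1) (b - 1) (by omega), hT.clip₁ (0 - 1) (b - 1) (by omega), hT.clip₁ a (b - 2) h]
  clip₂ := by
    intro a b h; simp only [hconv]
    rw [hT.clip₂ a b h, hT.clip₂ (a - 1) b h, hT.clip₂ a (b - 1) (by omega), hT.clip₂ a (0 - 1) (by omega),
      hT.clip₂ (a - 2) b h, hT.clip₂ (a - 1) (b - 1) (by omega), hT.clip₂ (a - 1) (0 - 1) (by omega),
      hT.clip₂ a (b - 2) (by omega), hT.clip₂ a (0 - 2) (by omega)]
  pos := by
    intro a b h; simp only [hconv]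
    have hL := hT.L_nonneg
    have t1 : 0 ≤ n00 * T a b := mul_nonneg h00 (hT.nonneg _ _)
    have t2 : 0 ≤ n10 * T (a - 1) b := mul_nonneg h10 (hT.nonneg _ _)
    have t3 : 0 ≤ n01 * T a (b - 1) := mul_nonneg h01 (hT.nonneg _ _)
    have t4 : 0 ≤ n20 * T (a - 2) b := mul_nonneg h20.le (hT.nonneg _ _)
    have t5 : 0 ≤ n11 * T (a - 1) (b - 1) := mul_nonneg h11.le (hT.nonneg _ _)
    have t6 : 0 ≤ n02 * T a (b - 2) := mul_nonneg h02.le (hT.nonneg _ _)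
    by_cases ha : 2 ≤ a
    · have := mul_pos h20 (hT.pos (a - 2) b (by omega)); linarith
    by_cases hb : 2 ≤ b
    · have := mul_pos h02 (hT.pos a (b - 2) (by omega)); linarith
    by_cases hab : a = 1 ∧ b = 1
    · have := mul_pos h11 (hT.pos (a - 1) (b - 1) (by omega)); linarith
    by_cases ha0 : a ≤ 0
    · have := mul_pos h02 (hT.pos a (b - 2) (by omega)); linarith
    · have := mul_pos h20 (hT.pos (a - 2) b (by omega)); linarith
  zero := by
    intro a b h; simp only [hconv]
    have hL := hT.L_nonneg
    rw [hT.zero a b (by omega), hT.zero (a - 1) b (by omega), hT.zero a (b - 1) (by omega),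
      hT.zero (a - 2) b (by omega), hT.zero (a - 1) (b - 1) (by omega), hT.zero a (b - 2) (by omega)]; ring
  anti₁ := by
    intro a b; simp only [hconv]
    have k1 := hT.anti₁ a b
    have k2 := hT.anti₁ (a - 1) b
    have k3 := hT.anti₁ a (b - 1)
    have k4 := hT.anti₁ (a - 2) b
    have k5 := hT.anti₁ (a - 1) (b - 1)
    have k6 := hT.anti₁ a (b - 2)
    rw [show a - 1 + 1 = a by ring] at k2 k5
    rw [show a - 2 + 1 = a - 1 by ring] at k4
    rw [show a + 1 - 1 = a by ring, show a + 1 - 2 = a - 1 by ring]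
    nlinarith [mul_le_mul_of_nonneg_left k1 h00, mul_le_mul_of_nonneg_left k2 h10,
      mul_le_mul_of_nonneg_left k3 h01, mul_le_mul_of_nonneg_left k4 h20.le,
      mul_le_mul_of_nonneg_left k5 h11.le, mul_le_mul_of_nonneg_left k6 h02.le]
  anti₂ := by
    intro a b; simp only [hconv]
    have k1 := hT.anti₂ a b
    have k2 := hT.anti₂ (a - 1) b
    have k3 := hT.anti₂ a (b - 1)
    have k4 := hT.anti₂ (a - 2) b
    have k5 := hT.anti₂ (a - 1) (b - 1)
    have k6 := hT.anti₂ a (b - 2)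
    rw [show b - 1 + 1 = b by ring] at k3 k5
    rw [show b - 2 + 1 = b - 1 by ring] at k6
    rw [show b + 1 - 1 = b by ring, show b + 1 - 2 = b - 1 by ring]
    nlinarith [mul_le_mul_of_nonneg_left k1 h00, mul_le_mul_of_nonneg_left k2 h10,
      mul_le_mul_of_nonneg_left k3 h01, mul_le_mul_of_nonneg_left k4 h20.le,
      mul_le_mul_of_nonneg_left k5 h11.le, mul_le_mul_of_nonneg_left k6 h02.le]
  m1 := hconv_m1' hT h00 h10 h01 h20.le h11.le h02.le hR1 hC1 hΛa hΛb
  m2 := hconv_m2' hT h00 h10 h01 h20.le h11.le h02.le hR2 hE hS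
  m4 := by
    intro a b
    -- the colour swap: m4 of `hconv n00 n10 n01 n20 n11 n02 T` is m2 of `hconv n00 n01 n10 n02 n11 n20 (swap T)`
    have h := hconv_m2' hT.swap h00 h01 h10 h02.le h11.le h20.le hC2 (by linarith [hE']) (by linarith [hS]) b a
    convert h using 2 <;> simp only [hconv] <;> ring

end Transport

section Counting

open V2Closure

/-- **the transport step on the configuration cubes**: if the counting tail of `X` is M♮-concave and
`Y` has max-flow `2` whose six flow counts satisfy the transport hypotheses (the flows `(2,0)`, `(1,1)`,
`(0,2)` all occurring), the counting tail of `X ∗ Y` is M♮-concave with top level `L + 2` -/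
theorem cnt_par_flow2_isMTail' {X : V2Closure.SP} {L : ℤ} (hX : IsMTail (cnt X) L) (Y : V2Closure.SP)
    (hY : FlowLeTwo Y)
    (h20 : ∃ y : Y.Conf, Y.rLab y = 2 ∧ Y.bLab y = 0) (h11 : ∃ y : Y.Conf, Y.rLab y = 1 ∧ Y.bLab y = 1)
    (h02 : ∃ y : Y.Conf, Y.rLab y = 0 ∧ Y.bLab y = 2)
    (hR2 : flowCount Y 0 0 * flowCount Y 2 0 ≤ flowCount Y 1 0 * flowCount Y 1 0 + flowCount Y 1 0 * flowCount Y 2 0)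
    (hC2 : flowCount Y 0 0 * flowCount Y 0 2 ≤ flowCount Y 0 1 * flowCount Y 0 1 + flowCount Y 0 1 * flowCount Y 0 2)
    (hS : flowCount Y 2 0 * flowCount Y 0 2 ≤ flowCount Y 1 1 * flowCount Y 1 1)
    (hE : flowCount Y 2 0 * flowCount Y 0 1 ≤ flowCount Y 1 0 * flowCount Y 1 1)
    (hE' : flowCount Y 0 2 * flowCount Y 1 0 ≤ flowCount Y 0 1 * flowCount Y 1 1)
    (hR1 : flowCount Y 0 0 * flowCount Y 2 0 ≤ flowCount Y 1 0 * flowCount Y 1 0 + flowCount Y 1 0 * flowCount Y 1 1)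
    (hC1 : flowCount Y 0 0 * flowCount Y 0 2 ≤ flowCount Y 0 1 * flowCount Y 0 1 + flowCount Y 0 1 * flowCount Y 1 1)
    (hΛa : flowCount Y 0 0 * flowCount Y 1 1 ≤ flowCount Y 1 0 * flowCount Y 0 1 + flowCount Y 0 1 * flowCount Y 2 0)
    (hΛb : flowCount Y 0 0 * flowCount Y 1 1 ≤ flowCount Y 1 0 * flowCount Y 0 1 + flowCount Y 1 0 * flowCount Y 0 2) :
    IsMTail (cnt (.par X Y)) (L + 2) := by
  have e : cnt (.par X Y) = hconv (flowCount Y 0 0) (flowCount Y 1 0) (flowCount Y 0 1) (flowCount Y 2 0)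
      (flowCount Y 1 1) (flowCount Y 0 2) (cnt X) :=
    funext (fun a => funext (fun b => cnt_par_flow2 X Y hY a b))
  rw [e]
  exact hconv_isMTail' hX (by positivity) (by positivity) (by positivity) (flowCount_pos h20)
    (flowCount_pos h11) (flowCount_pos h02) (by exact_mod_cast hR2) (by exact_mod_cast hC2)
    (by exact_mod_cast hS) (by exact_mod_cast hE) (by exact_mod_cast hE') (by exact_mod_cast hR1)
    (by exact_mod_cast hC1) (by exact_mod_cast hΛa) (by exact_mod_cast hΛb)

/-- the class `MTailPat` is closed under parallel composition with a max-flow-2 factor whose flow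
counts satisfy the transport hypotheses (either side) -/
theorem MTailPat.par_flow2' {s : V2Closure.SP} {L : ℤ} (hs : MTailPat s L) (Y : V2Closure.SP)
    (hY : FlowLeTwo Y)
    (h20 : ∃ y : Y.Conf, Y.rLab y = 2 ∧ Y.bLab y = 0) (h11 : ∃ y : Y.Conf, Y.rLab y = 1 ∧ Y.bLab y = 1)
    (h02 : ∃ y : Y.Conf, Y.rLab y = 0 ∧ Y.bLab y = 2)
    (hR2 : flowCount Y 0 0 * flowCount Y 2 0 ≤ flowCount Y 1 0 * flowCount Y 1 0 + flowCount Y 1 0 * flowCount Y 2 0)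
    (hC2 : flowCount Y 0 0 * flowCount Y 0 2 ≤ flowCount Y 0 1 * flowCount Y 0 1 + flowCount Y 0 1 * flowCount Y 0 2)
    (hS : flowCount Y 2 0 * flowCount Y 0 2 ≤ flowCount Y 1 1 * flowCount Y 1 1)
    (hE : flowCount Y 2 0 * flowCount Y 0 1 ≤ flowCount Y 1 0 * flowCount Y 1 1)
    (hE' : flowCount Y 0 2 * flowCount Y 1 0 ≤ flowCount Y 0 1 * flowCount Y 1 1)
    (hR1 : flowCount Y 0 0 * flowCount Y 2 0 ≤ flowCount Y 1 0 * flowCount Y 1 0 + flowCount Y 1 0 * flowCount Y 1 1)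
    (hC1 : flowCount Y 0 0 * flowCount Y 0 2 ≤ flowCount Y 0 1 * flowCount Y 0 1 + flowCount Y 0 1 * flowCount Y 1 1)
    (hΛa : flowCount Y 0 0 * flowCount Y 1 1 ≤ flowCount Y 1 0 * flowCount Y 0 1 + flowCount Y 0 1 * flowCount Y 2 0)
    (hΛb : flowCount Y 0 0 * flowCount Y 1 1 ≤ flowCount Y 1 0 * flowCount Y 0 1 + flowCount Y 1 0 * flowCount Y 0 2) :
    MTailPat (.par s Y) (L + 2) ∧ MTailPat (.par Y s) (L + 2) := by
  have h := cnt_par_flow2_isMTail' hs Y hY h20 h11 h02 hR2 hC2 hS hE hE' hR1 hC1 hΛa hΛb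
  refine ⟨h, ?_⟩
  unfold MTailPat
  have e : cnt (.par Y s) = cnt (.par s Y) := funext (fun a => funext (fun b => cnt_par_comm Y s a b))
  rw [e]; exact h

end Counting

end Summit.Ventures.PercRepro2.Tail2D
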